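import Summits.BirchSwinnertonDyer.Rank1Residual.O5.CrudeTransferReadings
import Summits.BirchSwinnertonDyer.Rank1Residual.O5.O5CompanionTransport
import Literature.NumberTheory.EllipticCurves.ModPReducibilityAlmostAllProofs
import Literature.NumberTheory.EllipticCurves.AnomalousOfRationalTorsionProofs
import Literature.NumberTheory.EllipticCurves.LFunctionPrimeCoeff
import HarnessLib

/-!
# O5 — a mod-`p` congruent companion of a curve with irreducible `E[p]` has NO rational
# `p`-torsion: the "automatic" input of T27-UPPER is a tree theorem (cell `b2b-bsdres`, lane
# CLASS-CLOSURE, class O5; harvest seat 2, GEN 52, E107)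

HONEST FRAMING (cell `b2b-bsdres`, run/shared/lean/b2b/bsd-rank1-residual/, verbatim in every
file): the goal of the cell is to DELETE the COMBINATION-SHAPED residual classes of the
Birch–Swinnerton-Dyer formula for ALL analytic-rank `≤ 1` elliptic curves over `ℚ` — "full BSD
formula for every rank `≤ 1` curve in class `C`" assembled STRICTLY from published theorems — so
that the rank-`≤ 1` remainder becomes exactly the CONSTRUCTION-SHAPED classes, which are TYPED
(missing-input `Prop`s), NOT attempted. This is not "finishing BSD". Lane CLASS-CLOSURE: research
routes; no claim beyond the stated classes; nothing is booked here; no mark of `RESIDUAL-MAP.md`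
moves; census numbers are EVIDENCE. THEOREMS ONLY (no definition, no named fact, no conjecture node;
net named-fact debt `0`); the node files `O5/O5TransferCertificate.lean`, `O5/O5GlobalLine.lean`,
`O5/O5CompanionTransport.lean` are not touched.

## What this file does

The O5 nodes quantify over pairs `W, G / ℚ` with `W[3]` irreducible and `a_ℓ(W) ≡ a_ℓ(G) (mod 3)`
at every prime `ℓ ∤ 3 N_W N_G` (`IsCongruentModThree W G`, `O5GlobalLine`; second clause of
`IsCompanionAtThree W G`, `O5CompanionTransport`).  Their docstrings note that then
"`ρ̄_G ≅ ρ̄_W` by Brauer–Nesbitt–Chebotarev", in particular `G(ℚ)[3] = 0` ("automatic",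
`CrudeTransferUpperUnitThree`); E103 (`CrudeTransferReadings`, GEN 48) had to carry that input as an
explicit binder `htors` of `crudeTransferUpperUnit_of_transfer`.  It is now PROVED, for every prime
`p` and every congruence off a finite set of primes:

* §1 **`natCard_torsionBy_eq_one_of_frobeniusTrace_congr_off_finite`** — `W, G` globally minimal
  elliptic curves over `ℚ`, `p` prime, `W[p]` an irreducible `Γ_ℚ`-module, `S ⊆ ℕ` finite, and
  `p ∣ a_ℓ(W) − a_ℓ(G)` at every prime `ℓ ∉ S` of good reduction for both: then `#G(ℚ)[p] = 1`
  (and `p ∤ #G(ℚ)_tors`, `not_dvd_torsionOrder_of_frobeniusTrace_congr_off_finite`).  Proof: a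
  rational point of order `p` on `G` gives `p ∣ #G̃(𝔽_ℓ)` at every good `ℓ ≥ 3`
  (`addOrderOf_dvd_reductionPointCount`, Silverman VII.3.1 (b)), i.e. `a_ℓ(G) ≡ ℓ + 1 (mod p)`,
  hence `a_ℓ(W) ≡ ℓ + 1 (mod p)` off a finite set, and then `W[p]` is reducible by the tree's
  theorem `not_irreducible_of_frobeniusTrace_congr_off_finite` (`ModPReducibilityAlmostAllProofs`:
  Darmon–Diamond–Taylor 1995 Prop. 2.6 (b) / Katz 1981 Thm. 2 in "almost all `ℓ`" form, proved from
  Frobenius' density theorem and the reduction of torsion) — contradiction.  No Brauer–Nesbitt, no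
  isomorphism `ρ̄_G ≅ ρ̄_W` is needed for the torsion statement.
* §2 **`natCard_torsionBy_eq_one_of_isCongruentModThree`**, **`…_of_isCompanionAtThree`**,
  `not_dvd_torsionOrder_of_isCongruentModThree` — the O5 spellings (`S = {ℓ ≤ 3 N_W N_G}`,
  `a_ℓ = LFunction ℓ` at good `ℓ`, `LFunction_apply_prime_eq_frobeniusTrace`).
* §3 **`crudeTransferUpperUnit_of_crudeSelmerTransfer : A18 → A24 → CrudeSelmerTransferThree →
  CrudeTransferUpperUnitThree`** — T27-UPPER IS a consequence of T27 granted Gross–Zagier–Kolyvagin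
  (registry A18) and the Cassels–Tate pairing (A24), with NO further binder: E103's
  `crudeTransferUpperUnit_of_transfer` fed with §2.  (T27-LOWER already was:
  `crudeTransferLowerNine_of_transfer`.)

T27 itself stays an `@[conjecture]` THEOREM-CANDIDATE; nothing here asserts it.

References: H. Darmon, F. Diamond, R. Taylor, *Fermat's Last Theorem* (1995) Prop. 2.6 (b),
Prop. 2.11 (a) [DarmonDiamondTaylor1995] (held `paper:doi-10-4310-cdm-1995-v1995-n1-a1`, PDF pp. 53–54,
57, read 2026-08-22); N. M. Katz, Invent. Math. 62 (1981) Thm. 2; J. H. Silverman, *AEC* (2009)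
Prop. VII.3.1 (b) [SilvermanAEC2009]; cell: `O5/O5TransferCertificate.lean`,
`O5/CrudeTransferReadings.lean`, HOME/b2b-bsdres-harvest-2/gen52/E107.
-/

set_option autoImplicit false

noncomputable section

open WeierstrassCurve Literature.NumberTheory.EllipticCurves

namespace Summit.BirchSwinnertonDyer.Rank1Residual.O5

/-! ## §1 General `p`: a congruent companion of a curve with irreducible `E[p]` has no rational `p`-torsion -/

section General

variable (W G : WeierstrassCurve ℚ) [W.IsElliptic] [W.IsGloballyMinimal] [G.IsElliptic]
  [G.IsGloballyMinimal] (p : ℕ) [Fact p.Prime]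

/-- **No rational `p`-torsion on a mod-`p` congruent companion of a curve with irreducible `E[p]`.**
Let `W, G / ℚ` be elliptic curves in global minimal form, `p` a prime with `W[p]` an irreducible
`Γ_ℚ`-module, and suppose `p ∣ a_ℓ(W) − a_ℓ(G)` for every prime `ℓ` outside a finite set `S` at
which both have good reduction.  Then `G(ℚ)[p] = 0`, i.e. `#G(ℚ)[p] = 1`.  (A point of order `p` in
`G(ℚ)` gives `p ∣ #G̃(𝔽_ℓ)`, i.e. `a_ℓ(G) ≡ ℓ + 1 (mod p)`, at every good `ℓ ≥ 3`, Silverman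
VII.3.1 (b); so `a_ℓ(W) ≡ ℓ + 1 (mod p)` off a finite set and `W[p]` would be reducible —
Darmon–Diamond–Taylor 1995 Prop. 2.6 (b), tree theorem
`not_irreducible_of_frobeniusTrace_congr_off_finite`.)
[cite: DarmonDiamondTaylor1995, Prop. 2.6 (b) and Prop. 2.11 (a) (PDF pp. 53–54, 57)]
[cite: SilvermanAEC2009, Prop. VII.3.1 (b)] -/
theorem natCard_torsionBy_eq_one_of_frobeniusTrace_congr_off_finite
    (hirr : W.HasIrreducibleModPGaloisRep p) (S : Set ℕ) (hS : S.Finite)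
    (hcong : ∀ (ℓ : ℕ) [Fact ℓ.Prime], ℓ ∉ S → W.HasGoodReductionAtPrime ℓ →
      G.HasGoodReductionAtPrime ℓ → (p : ℤ) ∣ W.frobeniusTrace ℓ - G.frobeniusTrace ℓ) :
    Nat.card (AddSubgroup.torsionBy G.toAffine.Point (p : ℤ)) = 1 := by
  rw [Nat.card_eq_one_iff_unique]
  refine ⟨⟨fun x y ↦ ?_⟩, ⟨0⟩⟩
  suffices hz : ∀ z : AddSubgroup.torsionBy G.toAffine.Point (p : ℤ), z = 0 by rw [hz x, hz y]
  intro z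
  by_contra hz
  have hp : p.Prime := Fact.out
  have hzp : p • (z : G.toAffine.Point) = 0 := AddSubgroup.torsionBy.nsmul_iff.mp z.2
  have hz0 : (z : G.toAffine.Point) ≠ 0 := fun h0 ↦ hz (Subtype.ext h0)
  have hord : addOrderOf (z : G.toAffine.Point) = p := addOrderOf_eq_prime hzp hz0
  have hfin : IsOfFinAddOrder (z : G.toAffine.Point) :=
    addOrderOf_pos_iff.mp (by rw [hord]; exact hp.pos)
  -- the exceptional primes: `S`, `ℓ = 2` and the divisors of `Δ_min(G)`
  have hΔ0 : minimalDiscriminantInt G ≠ 0 := minimalDiscriminantInt_ne_zero G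
  let S' : Set ℕ := S ∪ {ℓ | ℓ ≤ max 2 (minimalDiscriminantInt G).natAbs}
  have hS' : S'.Finite := hS.union (Set.finite_le_nat _)
  refine not_irreducible_of_frobeniusTrace_congr_off_finite W p S' hS'
    (fun ℓ _ hℓS' _ hgoodW ↦ ?_) hirr
  have hℓS : ℓ ∉ S := fun h ↦ hℓS' (Or.inl h)
  have hℓgt : max 2 (minimalDiscriminantInt G).natAbs < ℓ :=
    not_le.mp fun h ↦ hℓS' (Or.inr h)
  have h3ℓ : 3 ≤ ℓ := by
    have h2 := le_max_left 2 (minimalDiscriminantInt G).natAbs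
    omega
  have hℓΔ : ¬ (ℓ : ℤ) ∣ minimalDiscriminantInt G := fun h ↦ by
    have h1 := Nat.le_of_dvd (Int.natAbs_pos.mpr hΔ0) (Int.natCast_dvd.mp h)
    have h2 := le_max_right 2 (minimalDiscriminantInt G).natAbs
    omega
  have hgoodG : G.HasGoodReductionAtPrime ℓ := hasGoodReductionAtPrime_of_not_dvd G ℓ hℓΔ
  -- `p ∣ a_ℓ(W) − a_ℓ(G)` (congruence) and `p ∣ a_ℓ(G) − (ℓ + 1)` (rational `p`-torsion on `G`)
  have h1 : (p : ℤ) ∣ W.frobeniusTrace ℓ - G.frobeniusTrace ℓ := hcong ℓ hℓS hgoodW hgoodG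
  have h2 : (p : ℤ) ∣ G.frobeniusTrace ℓ - (ℓ + 1) := by
    refine (dvd_frobeniusTrace_sub_iff G p ℓ).mpr ?_
    have h := addOrderOf_dvd_reductionPointCount G ℓ h3ℓ hℓΔ hfin
    rwa [hord] at h
  have h12 := dvd_add h1 h2
  rwa [sub_add_sub_cancel] at h12

/-- **`p ∤ #G(ℚ)_tors` for a mod-`p` congruent companion `G` of a curve with irreducible `E[p]`**
(same hypotheses as `natCard_torsionBy_eq_one_of_frobeniusTrace_congr_off_finite`; Cauchy's theorem
in the finite group `G(ℚ)_tors`, tree `exists_addOrderOf_eq_of_dvd_torsionOrder`).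
[cite: DarmonDiamondTaylor1995, Prop. 2.6 (b) (PDF p. 53)] [cite: SilvermanAEC2009, Prop. VII.3.1 (b)] -/
theorem not_dvd_torsionOrder_of_frobeniusTrace_congr_off_finite
    (hirr : W.HasIrreducibleModPGaloisRep p) (S : Set ℕ) (hS : S.Finite)
    (hcong : ∀ (ℓ : ℕ) [Fact ℓ.Prime], ℓ ∉ S → W.HasGoodReductionAtPrime ℓ →
      G.HasGoodReductionAtPrime ℓ → (p : ℤ) ∣ W.frobeniusTrace ℓ - G.frobeniusTrace ℓ) :
    ¬ p ∣ G.torsionOrder := by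
  intro hdvd
  have hp : p.Prime := Fact.out
  obtain ⟨T, hT⟩ := exists_addOrderOf_eq_of_dvd_torsionOrder G p hdvd
  have hcard := natCard_torsionBy_eq_one_of_frobeniusTrace_congr_off_finite W G p hirr S hS hcong
  rw [Nat.card_eq_one_iff_unique] at hcard
  haveI := hcard.1
  have hTmem : T ∈ AddSubgroup.torsionBy G.toAffine.Point (p : ℤ) := by
    rw [AddSubgroup.torsionBy.nsmul_iff, ← hT]
    exact addOrderOf_nsmul_eq_zero T
  have hT0 : T = 0 := by
    have h := Subsingleton.elim (⟨T, hTmem⟩ : AddSubgroup.torsionBy G.toAffine.Point (p : ℤ))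
      ⟨0, AddSubgroup.zero_mem _⟩
    exact congrArg Subtype.val h
  have h1 : addOrderOf T = 1 := by rw [hT0, addOrderOf_zero]
  rw [hT] at h1
  exact hp.one_lt.ne' h1

end General

/-! ## §2 The O5 spellings: `IsCongruentModThree`, `IsCompanionAtThree` -/

section Three

variable (W G : WeierstrassCurve ℚ) [W.IsElliptic] [W.IsGloballyMinimal] [G.IsElliptic]
  [G.IsGloballyMinimal]

/-- `IsCongruentModThree W G` (the O5 vocabulary: `a_ℓ(W) ≡ a_ℓ(G) (mod 3)` as `LFunction` values in
`ZMod 3` at every prime `ℓ ∤ 3 N_W N_G`) gives the congruence of `frobeniusTrace`s off the finite set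
`{ℓ ≤ 3 N_W N_G}` at the primes of good reduction for both (`a_ℓ = LFunction ℓ` at good `ℓ`,
`LFunction_apply_prime_eq_frobeniusTrace`; `N > 0`, `conductorNorm_pos_holds`). [folklore] -/
theorem frobeniusTrace_congr_of_isCongruentModThree (hcong : IsCongruentModThree W G)
    (ℓ : ℕ) [Fact ℓ.Prime] (hℓ : ¬ ℓ ≤ 3 * W.conductorNorm ℤ * G.conductorNorm ℤ)
    (hgW : W.HasGoodReductionAtPrime ℓ) (hgG : G.HasGoodReductionAtPrime ℓ) :
    (3 : ℤ) ∣ W.frobeniusTrace ℓ - G.frobeniusTrace ℓ := by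
  have hℓp : ℓ.Prime := Fact.out
  have hN : 0 < 3 * W.conductorNorm ℤ * G.conductorNorm ℤ :=
    Nat.mul_pos (Nat.mul_pos (by norm_num) W.conductorNorm_pos_holds) G.conductorNorm_pos_holds
  have hndvd : ¬ ℓ ∣ 3 * W.conductorNorm ℤ * G.conductorNorm ℤ := fun h ↦ hℓ (Nat.le_of_dvd hN h)
  have h := hcong ℓ hℓp hndvd
  rw [LFunction_apply_prime_eq_frobeniusTrace W ℓ hgW, LFunction_apply_prime_eq_frobeniusTrace G ℓ hgG]
    at h
  have h' := (ZMod.intCast_eq_intCast_iff_dvd_sub _ _ 3).mp h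
  rw [Nat.cast_ofNat] at h'
  exact dvd_sub_comm.mp h'

/-- **A mod-3 congruent companion of a curve with irreducible `W[3]` has no rational `3`-torsion**:
`W[3]` irreducible and `IsCongruentModThree W G` give `#G(ℚ)[3] = 1` — the input "`G(ℚ)[3] = 0` is
automatic" of the node `CrudeTransferUpperUnitThree` (`O5TransferCertificate`), now a tree theorem
(§1 with `S = {ℓ ≤ 3 N_W N_G}`).
[cite: DarmonDiamondTaylor1995, Prop. 2.6 (b) (PDF p. 53)] [cite: SilvermanAEC2009, Prop. VII.3.1 (b)] -/
theorem natCard_torsionBy_eq_one_of_isCongruentModThree (hirr : W.HasIrreducibleModPGaloisRep 3)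
    (hcong : IsCongruentModThree W G) :
    Nat.card (AddSubgroup.torsionBy G.toAffine.Point 3) = 1 := by
  have h := natCard_torsionBy_eq_one_of_frobeniusTrace_congr_off_finite W G 3 hirr
    {ℓ | ℓ ≤ 3 * W.conductorNorm ℤ * G.conductorNorm ℤ} (Set.finite_le_nat _)
    (fun ℓ _ hℓS hgW hgG ↦ by
      have h3 := frobeniusTrace_congr_of_isCongruentModThree W G hcong ℓ hℓS hgW hgG
      rwa [Nat.cast_ofNat])
  rwa [Nat.cast_ofNat] at h

/-- **`3 ∤ #G(ℚ)_tors`** for a mod-3 congruent companion `G` of a curve with irreducible `W[3]`.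
[cite: DarmonDiamondTaylor1995, Prop. 2.6 (b) (PDF p. 53)] [cite: SilvermanAEC2009, Prop. VII.3.1 (b)] -/
theorem not_dvd_torsionOrder_of_isCongruentModThree (hirr : W.HasIrreducibleModPGaloisRep 3)
    (hcong : IsCongruentModThree W G) : ¬ 3 ∣ G.torsionOrder :=
  not_dvd_torsionOrder_of_frobeniusTrace_congr_off_finite W G 3 hirr
    {ℓ | ℓ ≤ 3 * W.conductorNorm ℤ * G.conductorNorm ℤ} (Set.finite_le_nat _)
    (fun ℓ _ hℓS hgW hgG ↦ by
      have h3 := frobeniusTrace_congr_of_isCongruentModThree W G hcong ℓ hℓS hgW hgG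
      rwa [Nat.cast_ofNat])

/-- **The clause `3 ∤ #G(ℚ)_tors` is automatic for a mod-3 congruent companion `G` of an X4 row `W` at `3`**
(`ClassX4 W 3 = (3 ≠ 2) ∧ Addv W 3 ∧ Irr W 3`): e.g. the torsion clause of the seed predicate
`IsUnitSupersingularSeedThree G` (`O5FouquetTransport`) is implied by the congruence whenever the seed serves
an X4 curve. [cite: DarmonDiamondTaylor1995, Prop. 2.6 (b) (PDF p. 53)] [cite: SilvermanAEC2009, Prop. VII.3.1 (b)] -/
theorem not_dvd_torsionOrder_of_classX4_of_isCongruentModThree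
    (hX : Literature.NumberTheory.EllipticCurves.Rank1Residual.ClassX4 W 3)
    (hcong : IsCongruentModThree W G) : ¬ 3 ∣ G.torsionOrder :=
  not_dvd_torsionOrder_of_isCongruentModThree W G hX.2.2 hcong

/-- **A semistable companion at `3` (`IsCompanionAtThree W G`, `O5CompanionTransport`) of a curve with
irreducible `W[3]` has no rational `3`-torsion** (its second clause is `IsCongruentModThree W G`).
[cite: DarmonDiamondTaylor1995, Prop. 2.6 (b) (PDF p. 53)] [cite: SilvermanAEC2009, Prop. VII.3.1 (b)] -/
theorem natCard_torsionBy_eq_one_of_isCompanionAtThree (hirr : W.HasIrreducibleModPGaloisRep 3)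
    (hcomp : IsCompanionAtThree W G) :
    Nat.card (AddSubgroup.torsionBy G.toAffine.Point 3) = 1 :=
  natCard_torsionBy_eq_one_of_isCongruentModThree W G hirr hcomp.2

/-- `3 ∤ #G(ℚ)_tors` for a semistable companion at `3` of a curve with irreducible `W[3]`.
[cite: DarmonDiamondTaylor1995, Prop. 2.6 (b) (PDF p. 53)] [cite: SilvermanAEC2009, Prop. VII.3.1 (b)] -/
theorem not_dvd_torsionOrder_of_isCompanionAtThree (hirr : W.HasIrreducibleModPGaloisRep 3)
    (hcomp : IsCompanionAtThree W G) : ¬ 3 ∣ G.torsionOrder :=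
  not_dvd_torsionOrder_of_isCongruentModThree W G hirr hcomp.2

end Three

/-! ## §3 T27-UPPER is a consequence of T27 (granted A18 and A24) — no further binder -/

/-- **T27 ⟹ T27-UPPER (the node `CrudeTransferUpperUnitThree`) granted Gross–Zagier–Kolyvagin (A18,
`rank_eq_analyticRank_of_analyticRank_le_one`) and the Cassels–Tate pairing (A24,
`WeierstrassCurve.exists_casselsTate_pairing`)** — E103's `crudeTransferUpperUnit_of_transfer` with
its last binder ("a mod-3 congruent companion of a curve with irreducible `W[3]` has no rational
`3`-torsion") DISCHARGED by `natCard_torsionBy_eq_one_of_isCongruentModThree`.  So both B-facing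
readings of T27 (LOWER: `crudeTransferLowerNine_of_transfer`; UPPER: this theorem) follow from T27
and the two registered facts A18, A24 alone.
[cite: SilvermanAEC2009, Thm. X.4.2 and X.4.14] [cite: DarmonDiamondTaylor1995, Prop. 2.6 (b) (PDF p. 53)] -/
theorem crudeTransferUpperUnit_of_crudeSelmerTransfer
    (hGZK : rank_eq_analyticRank_of_analyticRank_le_one)
    (hCT : WeierstrassCurve.exists_casselsTate_pairing (K := ℚ)) (hT : CrudeSelmerTransferThree) :
    CrudeTransferUpperUnitThree :=
  crudeTransferUpperUnit_of_transfer hGZK hCT hT fun W G _ _ _ _ hirr hcong ↦ by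
    convert natCard_torsionBy_eq_one_of_isCongruentModThree W G hirr hcong

end Summit.BirchSwinnertonDyer.Rank1Residual.O5

end
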